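import Mathlib.Analysis.Calculus.MeanValue
import Literature.Analysis.FunctionSpaces.ContDiffHolderComposition
import Literature.Analysis.FunctionSpaces.HolderAlgebra
import HarnessLib

/-!
# Pre-composition of `C^{k,r}_b` maps with smooth changes of variables (Hölder spaces, part 7)

Topic `Literature/Analysis/FunctionSpaces`. For `u ∈ C^{k,r}_b(E, F)` and a change of variables
`T : E' → E` of class `C^{k+1}` whose derivative lies in `C^{k,r}_b(E', E' →L[ℝ] E)` (e.g. every
derivative of `T` of order `1, …, k+1` bounded, `memContDiffHolder_fderiv_of_bounds`), the
composition `u ∘ T` lies in `C^{k,r}_b(E', F)` (`0 ≤ r ≤ 1`; `MemContDiffHolder.comp_right`,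
`ContDiffHolderFunction.compRight`). This is the chain-rule companion of part 6 (post-composition)
and the estimate behind "Hölder spaces on a manifold do not depend on the atlas up to equivalent
norms" (Gilbarg–Trudinger 2001, §6.2, change of coordinates in Lemma 6.5; Joyce 2007, §1.2):
chart transitions act boundedly on the chart pieces of part 4 (`HolderSpaceManifold.lean`).

Proof by induction on `k`, generalizing the target `F`: for `k = 0`, `T` is Lipschitz (mean value
theorem) and `[u ∘ T]_r ≤ [u]_r Lip(T)^r` (`memHolder_comp_lipschitzWith`); for `k → k+1`,
`D(u ∘ T) = (Du ∘ T) ∘L DT` is the pairing `ContinuousLinearMap.compL` of `Du ∘ T ∈ C^{k,r}_b`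
(induction hypothesis for `Du`) and `DT ∈ C^{k,r}_b`, in `C^{k,r}_b` by part 5
(`MemContDiffHolder.bilinear`), and `u ∘ T` is bounded. Everything is proved; no named facts.
Brick (1c′) of the census of `Literature.Geometry.Riemannian.gurskyViaclovsky_pathOpen_weighted_four`.

## References

* D. Gilbarg, N. S. Trudinger, *Elliptic Partial Differential Equations of Second Order* (2001),
  §4.1 and §6.2. [GilbargTrudinger2001]
-/

noncomputable section

open Set Filter Metric
open scoped NNReal ENNReal

universe u

namespace Literature.Analysis.FunctionSpaces

/-! ### Bounded derivatives give a Hölder derivative -/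

section Bounds

variable {E' E : Type*} [NormedAddCommGroup E'] [NormedSpace ℝ E'] [NormedAddCommGroup E]
  [NormedSpace ℝ E] {k : ℕ} {r : ℝ≥0}

/-- **A `C^{k+2}` change of variables with bounded derivatives of orders `1, …, k+2` has
derivative in `C^{k,r}_b`** (`r ≤ 1`; the top Hölder bound is the unit-scale interpolation
`holderWith_iteratedFDeriv_of_eSupNorm_ne_top`). [folklore] -/
theorem memContDiffHolder_fderiv_of_bounds (hr : r ≤ 1) {T : E' → E} (hT : ContDiff ℝ (k + 2) T)
    (hb : ∀ j : ℕ, 1 ≤ j → j ≤ k + 2 → eSupNorm (iteratedFDeriv ℝ j T) < ⊤) :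
    MemContDiffHolder k r (fderiv ℝ T) := by
  have hDT : ContDiff ℝ (k + 1) (fderiv ℝ T) := hT.fderiv_right (m := k + 1) (by norm_cast)
  have hsup : ∀ j : ℕ, j ≤ k + 1 → eSupNorm (iteratedFDeriv ℝ j (fderiv ℝ T)) < ⊤ := by
    intro j hj
    have h := hb (j + 1) (Nat.le_add_left 1 j) (by omega)
    have heq : eSupNorm (iteratedFDeriv ℝ j (fderiv ℝ T)) = eSupNorm (iteratedFDeriv ℝ (j + 1) T) := by
      simp only [eSupNorm, ← ofReal_norm, norm_iteratedFDeriv_fderiv]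
    rwa [heq]
  refine ⟨hDT.of_le (by exact_mod_cast Nat.le_succ k), fun j hj => hsup j (hj.trans (Nat.le_succ k)),
    ?_⟩
  exact (holderWith_iteratedFDeriv_of_eSupNorm_ne_top hDT (hsup (k + 1) le_rfl).ne
    (hsup k (Nat.le_succ k)).ne hr).memHolder

end Bounds

/-! ### Pre-composition -/

section Comp

variable {E' E : Type u} [NormedAddCommGroup E'] [NormedSpace ℝ E'] [NormedAddCommGroup E]
  [NormedSpace ℝ E] {r : ℝ≥0}

/-- **The case `k = 0`**: `u ∈ C^{0,r}_b`, `T ∈ C¹` with bounded derivative ⇒ `u ∘ T ∈ C^{0,r}_b`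
(`T` is Lipschitz by the mean value theorem, and `[u ∘ T]_r ≤ [u]_r Lip(T)^r`). [folklore] -/
theorem MemContDiffHolder.comp_right_zero {F : Type u} [NormedAddCommGroup F] [NormedSpace ℝ F]
    {u : E → F} (hu : MemContDiffHolder 0 r u) {T : E' → E} (hT : ContDiff ℝ 1 T)
    (hDT : MemContDiffHolder 0 r (_root_.fderiv ℝ T)) : MemContDiffHolder 0 r (u ∘ T) := by
  -- `T` is Lipschitz
  obtain ⟨L, hL⟩ := hDT.exists_norm_le
  set L' : ℝ≥0 := ⟨max L 0, le_max_right _ _⟩ with hL'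
  have hLip : LipschitzWith L' T := by
    refine lipschitzWith_of_nnnorm_fderiv_le (hT.differentiable one_ne_zero) fun x => ?_
    rw [← NNReal.coe_le_coe, coe_nnnorm]
    exact (hL x).trans (le_max_left _ _)
  refine ⟨(hu.1.comp (hT.of_le (by norm_cast))), fun j hj => ?_, ?_⟩
  · rw [Nat.le_zero.1 hj, eSupNorm_iteratedFDeriv_zero]
    obtain ⟨C, hC⟩ := eSupNorm_lt_top_iff.1 (by
      have h := hu.2.1 0 le_rfl
      rwa [eSupNorm_iteratedFDeriv_zero] at h)
    exact eSupNorm_lt_top_iff.2 ⟨C, fun x => hC (T x)⟩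
  · rw [memHolder_iteratedFDeriv_zero_iff]
    exact memHolder_comp_lipschitzWith (memHolder_iteratedFDeriv_zero_iff.1 hu.2.2) hLip

/-- **Pre-composition with a smooth change of variables preserves `C^{k,r}_b`**: for `r ≤ 1`,
`u ∈ C^{k,r}_b(E, F)`, `T ∈ C^{k+1}(E', E)` with `DT ∈ C^{k,r}_b(E', E' →L[ℝ] E)`, the composition
`u ∘ T` is in `C^{k,r}_b(E', F)`. Induction on `k` (generalizing `F`):
`D(u ∘ T) = (Du ∘ T) ∘L DT` (chain rule) is the `compL` pairing of `Du ∘ T ∈ C^{k,r}_b` (hypothesis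
for `Du`) and `DT ∈ C^{k,r}_b`, in `C^{k,r}_b` by the Leibniz rule. [cite: GilbargTrudinger2001, §4.1] -/
theorem MemContDiffHolder.comp_right (hr : r ≤ 1) :
    ∀ {k : ℕ} {F : Type u} [NormedAddCommGroup F] [NormedSpace ℝ F] {u : E → F},
      MemContDiffHolder k r u → ∀ {T : E' → E}, ContDiff ℝ (k + 1) T →
        MemContDiffHolder k r (_root_.fderiv ℝ T) → MemContDiffHolder k r (u ∘ T) := by
  intro k
  induction k with
  | zero =>
    intro F _ _ u hu T hT hDT
    exact hu.comp_right_zero hT hDT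
  | succ k ih =>
    intro F _ _ u hu T hT hDT
    -- ingredients
    have hT1 : ContDiff ℝ 1 T := hT.of_le (by norm_cast; omega)
    have hT' : ContDiff ℝ (k + 1) T := hT.of_le (by exact_mod_cast Nat.le_succ _)
    have hDT' : MemContDiffHolder k r (_root_.fderiv ℝ T) := hDT.of_succ hr
    have hDu : MemContDiffHolder k r (_root_.fderiv ℝ u) := hu.fderiv
    have hDuT : MemContDiffHolder k r (_root_.fderiv ℝ u ∘ T) := ih hDu hT' hDT'
    -- the derivative of the composition is the pairing `compL`
    have hpair : MemContDiffHolder k r fun x =>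
        ContinuousLinearMap.compL ℝ E' E F ((_root_.fderiv ℝ u ∘ T) x) (_root_.fderiv ℝ T x) :=
      hDuT.bilinear hr (ContinuousLinearMap.compL ℝ E' E F) hDT'
    have hchain : _root_.fderiv ℝ (u ∘ T) = fun x =>
        ContinuousLinearMap.compL ℝ E' E F ((_root_.fderiv ℝ u ∘ T) x) (_root_.fderiv ℝ T x) := by
      funext x
      rw [ContinuousLinearMap.compL_apply, Function.comp_apply]
      exact fderiv_comp x (hu.1.differentiable (by exact_mod_cast Nat.succ_ne_zero k) (T x))
        (hT1.differentiable one_ne_zero x)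
    -- boundedness of `u ∘ T`
    obtain ⟨C, hC⟩ := hu.exists_norm_le
    refine memContDiffHolder_succ_iff.2 ⟨hu.1.comp hT', ?_, ?_⟩
    · exact eSupNorm_lt_top_iff.2 ⟨C, fun x => hC (T x)⟩
    · rw [hchain]
      exact hpair

/-- **Pre-composition with bounded-derivative changes of variables** (hypotheses on `T` only:
`C^{k+2}` with bounded derivatives of orders `1, …, k+2`). [folklore] -/
theorem MemContDiffHolder.comp_right_of_bounds (hr : r ≤ 1) {k : ℕ} {F : Type u}
    [NormedAddCommGroup F] [NormedSpace ℝ F] {u : E → F} (hu : MemContDiffHolder k r u)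
    {T : E' → E} (hT : ContDiff ℝ (k + 2) T)
    (hb : ∀ j : ℕ, 1 ≤ j → j ≤ k + 2 → eSupNorm (iteratedFDeriv ℝ j T) < ⊤) :
    MemContDiffHolder k r (u ∘ T) :=
  hu.comp_right hr (hT.of_le (by exact_mod_cast Nat.le_succ _))
    (memContDiffHolder_fderiv_of_bounds hr hT hb)

namespace ContDiffHolderFunction

/-- **Pre-composition with a smooth change of variables** on the bundled spaces:
`compRight hr T hT hDT u = u ∘ T ∈ C^{k,r}_b(E', F)`. [cite: GilbargTrudinger2001, §4.1] -/
def compRight (hr : r ≤ 1) {k : ℕ} {F : Type u} [NormedAddCommGroup F] [NormedSpace ℝ F]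
    (T : E' → E) (hT : ContDiff ℝ (k + 1) T) (hDT : MemContDiffHolder k r (fderiv ℝ T))
    (u : ContDiffHolderFunction E F k r) : ContDiffHolderFunction E' F k r :=
  ⟨u ∘ T, u.memContDiffHolder.comp_right hr hT hDT⟩

/-- Pointwise: `compRight hr T hT hDT u x = u (T x)`. [folklore] -/
@[simp]
theorem compRight_apply (hr : r ≤ 1) {k : ℕ} {F : Type u} [NormedAddCommGroup F] [NormedSpace ℝ F]
    (T : E' → E) (hT : ContDiff ℝ (k + 1) T) (hDT : MemContDiffHolder k r (fderiv ℝ T))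
    (u : ContDiffHolderFunction E F k r) (x : E') : compRight hr T hT hDT u x = u (T x) := rfl

/-- `compRight` is additive. [folklore] -/
theorem compRight_add (hr : r ≤ 1) {k : ℕ} {F : Type u} [NormedAddCommGroup F] [NormedSpace ℝ F]
    (T : E' → E) (hT : ContDiff ℝ (k + 1) T) (hDT : MemContDiffHolder k r (fderiv ℝ T))
    (u v : ContDiffHolderFunction E F k r) :
    compRight hr T hT hDT (u + v) = compRight hr T hT hDT u + compRight hr T hT hDT v :=
  ContDiffHolderFunction.ext fun _ => rfl

/-- `compRight` is real-homogeneous. [folklore] -/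
theorem compRight_smul (hr : r ≤ 1) {k : ℕ} {F : Type u} [NormedAddCommGroup F] [NormedSpace ℝ F]
    (T : E' → E) (hT : ContDiff ℝ (k + 1) T) (hDT : MemContDiffHolder k r (fderiv ℝ T))
    (a : ℝ) (u : ContDiffHolderFunction E F k r) :
    compRight hr T hT hDT (a • u) = a • compRight hr T hT hDT u :=
  ContDiffHolderFunction.ext fun _ => rfl

/-- `compRight` as a linear map `C^{k,r}_b(E, F) →ₗ[ℝ] C^{k,r}_b(E', F)`. [folklore] -/
def compRightₗ (hr : r ≤ 1) {k : ℕ} {F : Type u} [NormedAddCommGroup F] [NormedSpace ℝ F]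
    (T : E' → E) (hT : ContDiff ℝ (k + 1) T) (hDT : MemContDiffHolder k r (fderiv ℝ T)) :
    ContDiffHolderFunction E F k r →ₗ[ℝ] ContDiffHolderFunction E' F k r where
  toFun := compRight hr T hT hDT
  map_add' := compRight_add hr T hT hDT
  map_smul' := compRight_smul hr T hT hDT

end ContDiffHolderFunction

end Comp

end Literature.Analysis.FunctionSpaces

end
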